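import Mathlib
import Summits.ValiantsHypothesis.ValiantsHypothesis.Theorems.NewtonTauWeak.Negative.Zonogon
import Summits.ValiantsHypothesis.ValiantsHypothesis.Theorems.NewtonUnitEquationsDissociatedUniformGreedyCharts

/-!
# Stub ideas k = 2 (FAMILY 2 — RESHAPE) for `stub_binomialNewtonTauCommon` (crux `NewtonTauWeak`, stmt-5904)

Typed helper statements for `STUB-IDEAS-stub_binomialNewtonTauCommon-2.md`.  `sorry` everywhere: this file only
certifies that the proposed helper lemmas ELABORATE over existing declarations.
-/

set_option linter.dupNamespace false

noncomputable section

open scoped BigOperators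
open MvPolynomial
open Summit.ValiantsHypothesis.ValiantsHypothesis.Theorems.NewtonTauWeak.Negative (vert)
open Summit.ValiantsHypothesis.ValiantsHypothesis.Theorems.NewtonUnitEquationsDissociatedUniform (QuasiPoly.gE
  QuasiPoly.cshadow QuasiPoly.lin)

namespace Summit.ValiantsHypothesis.ValiantsHypothesis.Cruxes.NewtonTauWeak.StubIdeasBinomialCommon2

/-! ## PLAN A — bounded-weight level sets: LP (ratio-order) cells + Steinitz proximity -/

/-- A1 (S) — class-prefix normal form: an optimal word of weight `v` may be taken to be a key-prefix
(key `(c j, j)`) inside every weight class, with the same class counts. [exchange inside a class] -/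
theorem A1_classPrefix (N v : ℕ) (g : Fin N → ℕ) (c : Fin N → ℝ)
    (J : Finset (Fin N)) (hJ : ∑ j ∈ J, g j = v)
    (hmax : ∀ J' : Finset (Fin N), ∑ j ∈ J', g j = v → ∑ j ∈ J', c j ≤ ∑ j ∈ J, c j) :
    ∃ J₀ : Finset (Fin N), ∑ j ∈ J₀, g j = v ∧ ∑ j ∈ J₀, c j = ∑ j ∈ J, c j ∧
      (∀ i : ℕ, (J₀.filter fun j => g j = i).card = (J.filter fun j => g j = i).card) ∧
      ∀ j ∈ J₀, ∀ j', j' ∉ J₀ → g j' = g j → (c j' < c j ∨ (c j' = c j ∧ j' < j)) := by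
  sorry

/-- A2 (M) — proximity of an integer optimum to the ratio-greedy (LP) prefix `P`: Steinitz in dimension one.
`P` = a set of weighted items whose ratios `c j / g j` dominate those of the weighted items outside, of weight in
`[v - cB, v]`.  Some optimal word differs from `P` on at most `2 cB + 2` weighted items.
[EisenbrandWeismantel2018 arXiv:1707.00481 §3 Thm 7 (`‖z*−x*‖₁ ≤ m(2mΔ+1)^m`), case `m = 1`] -/
theorem A2_proximity (N cB v : ℕ) (g : Fin N → ℕ) (hg : ∀ j, g j ≤ cB) (c : Fin N → ℝ)
    (P : Finset (Fin N)) (hP0 : ∀ j ∈ P, 1 ≤ g j)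
    (hP : ∀ j ∈ P, ∀ j', j' ∉ P → 1 ≤ g j' → c j' * g j ≤ c j * g j')
    (hPw : ∑ j ∈ P, g j ≤ v) (hPv : v ≤ ∑ j ∈ P, g j + cB)
    (J : Finset (Fin N)) (hJ : ∑ j ∈ J, g j = v)
    (hmax : ∀ J' : Finset (Fin N), ∑ j ∈ J', g j = v → ∑ j ∈ J', c j ≤ ∑ j ∈ J, c j) :
    ∃ J₀ : Finset (Fin N), ∑ j ∈ J₀, g j = v ∧ ∑ j ∈ J₀, c j = ∑ j ∈ J, c j ∧
      ((J₀ \ P).filter fun j => 1 ≤ g j).card + (P \ J₀).card ≤ 2 * cB + 2 := by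
  sorry

/-- A3 (M) — cell normal form: for a direction `w` generic for the scaled exponents, the exposed word is
`F σ δ`, where `σ` is the sign vector of the `N·N + N` linear functionals `w ↦ ⟨w, g j' • d j - g j • d j'⟩`,
`w ↦ ⟨w, d j⟩` (it fixes the ratio order, the class orders, the LP prefix and the signs) and `δ : Fin cB → ℤ`,
`Σ |δ i| ≤ 2 cB + 2`, records the class-count corrections of A1/A2. -/
theorem A3_cellNormalForm (N cB v : ℕ) (g : Fin N → ℕ) (hg : ∀ j, g j ≤ cB) (d : Fin N → (Fin 2 →₀ ℕ))
    (hd : ∀ j, d j ≠ 0) :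
    ∃ F : (Fin N × Fin N ⊕ Fin N → SignType) → (Fin cB → ℤ) → Finset (Fin N),
      ∀ w : Fin 2 → ℝ,
        Set.InjOn (fun e : Fin 2 →₀ ℕ => ∑ i, w i * ((e i : ℕ) : ℝ))
          ((insert 0 ((Finset.univ.image d) ∪
            ((Finset.univ : Finset (Fin N × Fin N)).image fun p => g p.2 • d p.1))) :
            Set (Fin 2 →₀ ℕ)) →
        ∀ J : Finset (Fin N), ∑ j ∈ J, g j = v →
          (∀ J' : Finset (Fin N), ∑ j ∈ J', g j = v → ∑ j ∈ J', d j ≠ ∑ j ∈ J, d j →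
            ∑ i, w i * (((∑ j ∈ J', d j) i : ℕ) : ℝ) < ∑ i, w i * (((∑ j ∈ J, d j) i : ℕ) : ℝ)) →
          ∃ δ : Fin cB → ℤ, ∑ i, |δ i| ≤ 2 * cB + 2 ∧
            ∑ j ∈ F (fun m => m.elim
                (fun p => SignType.sign (∑ i, w i * ((g p.2 : ℝ) * ((d p.1 i : ℕ) : ℝ) - (g p.1 : ℝ) * ((d p.2 i : ℕ) : ℝ))))
                (fun j => SignType.sign (∑ i, w i * ((d j i : ℕ) : ℝ)))) δ, d j = ∑ j ∈ J, d j := by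
  sorry

/-- A4 (M, assembly = THEOREM G_c) — hull vertices of a bounded-weight knapsack level set are polynomial in `N`,
FPT in the weight bound: `#vert conv {Σ_J d : Σ_J g = v} ≤ (4(N²+N)+5)·(4 cB + 5)^{cB}`.
(A3 + `ResidueDesignHullAux.signvec_plane_count` + `#{δ} ≤ (4cB+5)^{cB}`.) -/
theorem A4_weightedLevelHull (N cB v : ℕ) (g : Fin N → ℕ) (hg : ∀ j, g j ≤ cB)
    (d : Fin N → (Fin 2 →₀ ℕ)) (hd : ∀ j, d j ≠ 0) :
    (Set.extremePoints ℝ (convexHull ℝ ((fun e : Fin 2 →₀ ℕ => fun i : Fin 2 => ((e i : ℕ) : ℝ)) ''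
      (((Finset.univ.filter fun J : Finset (Fin N) => ∑ j ∈ J, g j = v).image
        fun J => ∑ j ∈ J, d j : Finset (Fin 2 →₀ ℕ)) : Set (Fin 2 →₀ ℕ))))).ncard ≤
      (4 * (N * N + N) + 5) * (4 * cB + 5) ^ cB := by
  sorry

/-- A5 (M) — T2 for MULTIPLICATIVE RANK-ONE designs with bounded integer weights, uniformly (indeed free) in `K`:
`ρ_{lj} = ρ_j · λ_l^{g_j}`, any scalars `c_l`, any `K`; on a dissociated list the support is the union of the level
sets `{Σ_J g = v}` with `φ(v) = Σ_l c_l λ_l^v ≠ 0`, `v ≤ cB·N`; union of supports (`hex_newtonVertexCount_iUnion_le`)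
+ A4. -/
theorem A5_rankOneDesignT2 (K N cB : ℕ) (g : Fin N → ℕ) (hg : ∀ j, g j ≤ cB)
    (c lam : Fin K → ℂ) (ρ : Fin N → ℂ) (hρ : ∀ j, ρ j ≠ 0)
    (d : Fin N → (Fin 2 →₀ ℕ)) (hd : ∀ j, d j ≠ 0)
    (hdis : ∀ J J' : Finset (Fin N), ∑ j ∈ J, d j = ∑ j ∈ J', d j → J = J') :
    vert (∑ l, C (c l) * ∏ j, (1 - C (ρ j * lam l ^ g j) * monomial (d j) 1)) ≤
      2 * (cB * N + 1) * ((4 * (N * N + N) + 5) * (4 * cB + 5) ^ cB) := by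
  sorry

/-! ## PLAN B — the stub's shadow strengthening T2♯ and the one-binomial recursion -/

/-- B1 (M) — top survivor is greedy, plain form: for ANY scalars, the Newton vertices of `Σ_l c_l P_l` lie in the
configuration shadow of the coefficient configuration `e ↦ (coeff e P_l)_l`.  (cf. `stub_topSurvivorGreedy`,
`stub_boxGreedy`: same proof via `stub_exposedGenericDirection`.) -/
theorem B1_vert_le_cshadow (K : ℕ) (E : Finset (Fin 2 →₀ ℕ)) (P : Fin K → MvPolynomial (Fin 2) ℂ)
    (hE : ∀ l, (P l).support ⊆ E) (c : Fin K → ℂ) :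
    vert (∑ l, C (c l) * P l) ≤
      (QuasiPoly.cshadow E (fun e l => coeff e (P l)) (fun e => ((e 0 : ℕ) : ℝ)) (fun e => ((e 1 : ℕ) : ℝ))).ncard := by
  sorry

/-- B2 (M) — the SCALAR step is exact (vector Ostrowski): multiplying every `P_l` by the SAME binomial `1 - ρ X^d`
does not change the greedy set in any injective direction `w` with `⟨w, d⟩ < 0` (and translates it by `d` when
`⟨w, d⟩ > 0`, `ρ ≠ 0`): spans above a point coincide (`x(q) = Σ_i ρ^i z(q - i d)`), and `z(p) ≡ x(p)` modulo them. -/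
theorem B2_scalarStep_neg (K : ℕ) (E : Finset (Fin 2 →₀ ℕ)) (P : Fin K → MvPolynomial (Fin 2) ℂ) (ρ : ℂ)
    (d : Fin 2 →₀ ℕ) (hE : ∀ l, (P l).support ⊆ E)
    (hE' : ∀ l, ((1 - C ρ * monomial d 1) * P l).support ⊆ E)
    (w : Fin 2 → ℝ) (hw : ∑ i, w i * ((d i : ℕ) : ℝ) < 0)
    (hinj : Set.InjOn (QuasiPoly.lin (fun e : Fin 2 →₀ ℕ => ((e 0 : ℕ) : ℝ)) (fun e => ((e 1 : ℕ) : ℝ)) w)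
      (E : Set (Fin 2 →₀ ℕ))) :
    QuasiPoly.gE E (fun e l => coeff e ((1 - C ρ * monomial d 1) * P l))
        (QuasiPoly.lin (fun e : Fin 2 →₀ ℕ => ((e 0 : ℕ) : ℝ)) (fun e => ((e 1 : ℕ) : ℝ)) w) =
      QuasiPoly.gE E (fun e l => coeff e (P l))
        (QuasiPoly.lin (fun e : Fin 2 →₀ ℕ => ((e 0 : ℕ) : ℝ)) (fun e => ((e 1 : ℕ) : ℝ)) w) := by
  sorry

/-- B3 — the typed residual of PLAN B: the SHADOW form T2♯ of the stub (c-free; Theorem Q's invariant), which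
implies the stub by B1 with `E ⊇` all supports. -/
def BinomialShadowBound (b : ℕ) : Prop :=
  ∀ (K N : ℕ) (ρ : Fin K → Fin N → ℂ) (d : Fin N → (Fin 2 →₀ ℕ)) (E : Finset (Fin 2 →₀ ℕ)),
    (∀ l, (∏ j, (1 - C (ρ l j) * monomial (d j) (1 : ℂ))).support ⊆ E) →
    (QuasiPoly.cshadow E (fun e l => coeff e (∏ j, (1 - C (ρ l j) * monomial (d j) (1 : ℂ))))
      (fun e => ((e 0 : ℕ) : ℝ)) (fun e => ((e 1 : ℕ) : ℝ))).ncard ≤ (K * N + 2) ^ b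

/-- B3 → stub (S, from B1). -/
theorem stub_of_shadowBound (b : ℕ) (h : BinomialShadowBound b) :
    ∀ (K N : ℕ) (c : Fin K → ℂ) (ρ : Fin K → Fin N → ℂ) (d : Fin N → (Fin 2 →₀ ℕ)),
      vert (∑ l, C (c l) * ∏ j, (1 - C (ρ l j) * monomial (d j) 1)) ≤ (K * N + 2) ^ b := by
  sorry

end Summit.ValiantsHypothesis.ValiantsHypothesis.Cruxes.NewtonTauWeak.StubIdeasBinomialCommon2

end
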